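import Summits.BirchSwinnertonDyer.BirchSwinnertonDyer.Theorems.ErratumRoadFiveShimuraKolyvaginOrderBoundInertMachineEntry
import Summits.BirchSwinnertonDyer.Rank1Residual.X11b.KolyvaginReciprocityOfPoitouTate
import HarnessLib

/-!
# Route `ErratumRoadFive`, crux `ShimuraKolyvaginOrderBoundInertFromFive` (item
# stmt-BirchSwinnertonDyer-19718) — Kolyvagin reciprocity (R)_M from Poitou–Tate re-keyed on the
# conductor, and S1's `Nat.card` shape on the 19718 ∧ (ii) locus modulo the ring-class-rational carrier

Cell `bsd-stepL`, seat `bsd-stepL-shim-p1` (prover g7), HELPER for the crux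
`Summit.BirchSwinnertonDyer.BirchSwinnertonDyer.Theses.ErratumRoadFive.ShimuraKolyvaginOrderBoundInertFromFive`
(`--supports stmt-BirchSwinnertonDyer-19718 --as helper`; K2 route `route-BirchSwinnertonDyer-ErratumRoadFive`
rev 19; skeleton v2 df9d5864b1b31f6b, stub S1 `stub_inert_unitIndex`). Third file of the session after
`…InertLocalAll` (p469959: clause (d) of `hpoints` from ring-class rationality) and `…InertMachineEntry`
(p470900: the machine's `m₀ = 0` entry keyed on the conductor; END `sha_primary_eq_zero_of_ringClassRationalPointsM`).
* §1 `kolyvaginReciprocityM_of_poitouTate_of_conductorNorm` — x11b3's (R)_M-from-Poitou–Tate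
  (`X11b/KolyvaginReciprocityOfPoitouTate.lean`, `KolyvaginReciprocity.kolyvaginReciprocityM_of_poitouTate`)
  with its one use of `IsHeegnerPoint` (good reduction at `λ`) replaced by `W.conductorNorm ℤ = N`;
  proof copied token for token (adapted), CONDITIONAL on the named fact `hPT` (Poitou–Tate).
* §2 `dvd_index_zmultiples_nsmul_of_not_isOfFinAddOrder`, `nsmul_ne_of_padicValNat_index_eq_zero` — the
  index guard `0 < [E(K):ℤP] ∧ ord_p [E(K):ℤP] = 0 ∧ P non-torsion ⟹ P ∉ pE(K)`.
* §3 **`natCard_primaryComponent_sha_le_of_ringClassRationalPointsM_of_poitouTate`** — S1's CONCLUSION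
  `Nat.card Ш(E/K)[p^∞] ≤ p^{2·ord_p index}` on the crux's binders + `hTam` + `0 < index`, from the
  ring-class-rational leaf `hpointsR` and `hPT` only.
HONEST FRAMING: THEOREMS ONLY (no `def`, no named fact, no `sorry`; axioms standard; §1 and §3 take the
Literature named fact `poitouTate_sum_localTatePairing_eq_zero K` as a hypothesis ⇒ conditional). S1 ∕ S2
and item 19718 stay OPEN: the Shimura Euler-system CARRIER (`hpointsR`: CM points of conductor `m` on
`X_{N⁺,N⁻}` over `K[m]`, eigen relation, McCallum's key relation — BD96 §2, Nekovář 2007 §4, CST14) is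
printed but not in the tree; `hTam` and `0 < index` are not clauses of the item as typed (S1S2-ROAD §1–§2).
BSD is not proved by any of this; no census number moves. [cite: McCallumLMS1991, §2 Prop. 2.2, §5 Lemmas
5.1, 5.3] [cite: GrossLMS1991, Prop. 2.1 (2), §7 (7.6), Prop. 8.2, §9] [cite: MilneADT2006, Ch. I Thm. 4.10(b)]
[cite: Kim2022HigherGZ, §2.1 and Thm. 4.3]. presearch: as `…InertMachineEntry` (S1S2-ROAD §4, corpus +
galaxy); `lean search 'of_poitouTate_of_conductorNorm|padicValNat_index_eq_zero'` → no matches. -/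

noncomputable section

open scoped Classical Pointwise AddSubgroup

set_option linter.dupNamespace false

namespace Summit.BirchSwinnertonDyer.BirchSwinnertonDyer.Theorems

open WeierstrassCurve NumberField IsDedekindDomain Field Function ValuativeRel
  Literature.NumberTheory.EllipticCurves Literature.NumberTheory.EllipticCurves.KolyvaginCocycle
  Literature.NumberTheory.EllipticCurves.RingClassField
  Literature.NumberTheory.GaloisRepresentations Literature.NumberTheory.NumberFields
  Literature.NumberTheory.GaloisRepresentations.IsNonarchimedeanLocalField
  Literature.NumberTheory.GaloisCohomology
  Summit.BirchSwinnertonDyer.Rank1Residual.X11b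
  Summit.BirchSwinnertonDyer.Rank1Residual.X11b.KolyvaginReciprocity
open Literature.NumberTheory.GaloisRepresentations.DiscreteGaloisModule (mu MuCarrier)

variable {K : Type} [Field K] [NumberField K]

/-! ### §1 Kolyvagin reciprocity (R)_M from Poitou–Tate, keyed on the conductor -/

/-- **Kolyvagin reciprocity (R)_M at a Kolyvagin prime, from Poitou–Tate — conductor-keyed twin of
x11b3's `KolyvaginReciprocity.kolyvaginReciprocityM_of_poitouTate`.** For `E = W/ℚ` elliptic of conductor
`N`, a number field `K`, a prime `p`, `M ≥ 1` and a Kolyvagin prime `ℓ` of level `N` (the condition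
`Frob(ℓ) = Frob(∞)` on `K(E[p^M])` of the machine's `hR` binder is not needed): CONDITIONAL on the named fact
`hPT : poitouTate_sum_localTatePairing_eq_zero K` (Poitou–Tate, Milne *ADT* I Thm. 4.10(b); cite-only),
the Weil pairing `e` on `E[p^M]` has `e([s, F], [c', σ]) = 0` for every `s ∈ Sel_{p^M}(E/K)`, every
`c' ∈ H¹(K, E[p^M])` Selmer off `λ` and at infinity, every `𝔔 ∣ λ`, Frobenius `F` at `𝔔` fixing `E[p^M]`
and `σ ∈ I_𝔔` (McCallum 1991 Prop. 2.2 at `λ` + Gross 1991 (7.6)). SAME proof as x11b3's (adapted from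
`X11b/KolyvaginReciprocityOfPoitouTate.lean`), EXCEPT that `IsHeegnerPoint N W K P` — used there once,
for good reduction at `λ` — is replaced by `W.conductorNorm ℤ = N`; the idle binders of the original are
dropped. Output shape = the `hR` binder of `…MachineEntry` §3–§4 at the level `M`.
[cite: McCallumLMS1991, §2 Prop. 2.2, §5 Lemma 5.3] [cite: GrossLMS1991, §7 (7.1), (7.6), Prop. 8.2, §9]
[cite: MilneADT2006, Ch. I Thm. 4.10(b), Cor. 2.3, Prop. 3.8] [cite: NeukirchANT1999, Ch. II §9 Prop. (9.6)] -/
theorem kolyvaginReciprocityM_of_poitouTate_of_conductorNorm {N : ℕ} [NeZero N]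
    (W : WeierstrassCurve ℚ) [W.IsElliptic] (hN : W.conductorNorm ℤ = N)
    (hPT : poitouTate_sum_localTatePairing_eq_zero K) {p : ℕ} (hp : p.Prime) {M : ℕ} (hM : 1 ≤ M)
    {ℓ : ℕ} (hℓ : IsKolyvaginPrime N W K p ℓ) :
    ∃ (A : Type) (_ : AddCommGroup A)
      (e : geomTorsion (W.baseChange K) ((p ^ M : ℕ) : ℤ) →+
        geomTorsion (W.baseChange K) ((p ^ M : ℕ) : ℤ) →+ A),
      (∀ x, e x x = 0) ∧ (∀ x, (∀ y, e x y = 0) → x = 0) ∧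
      ∀ s ∈ selmerGroup (W.baseChange K) ((p ^ M : ℕ) : ℤ),
        ∀ c' : galH1Torsion (W.baseChange K) ((p ^ M : ℕ) : ℤ),
        (∀ v : HeightOneSpectrum (𝓞 K), (ℓ : 𝓞 K) ∉ v.asIdeal →
          c' ∈ selmerLocalKer (W.baseChange K) (v.adicCompletion K) ((p ^ M : ℕ) : ℤ)) →
        (∀ w : InfinitePlace K,
          c' ∈ selmerLocalKer (W.baseChange K) w.Completion ((p ^ M : ℕ) : ℤ)) →
        ∀ 𝔔 ∈ hℓ.place.primesAbove, ∀ F : Field.absoluteGaloisGroup K,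
          IsArithFrobAt (𝓞 K) F 𝔔 →
          F ∈ torsionFixing (W.baseChange K) ((p ^ M : ℕ) : ℤ) →
          ∀ σ ∈ 𝔔.inertia (Field.absoluteGaloisGroup K),
          e (h1Eval (W.baseChange K) ((p ^ M : ℕ) : ℤ) s F)
            (h1Eval (W.baseChange K) ((p ^ M : ℕ) : ℤ) c' σ) = 0 := by
  -- adapted from X11b/KolyvaginReciprocityOfPoitouTate.lean (x11b3-p3), `hP` ↦ `hN`
  -- compactness of absolute Galois groups (cup products), as a local hypothesis
  have _hΓc : ∀ (L : Type) [Field L], CompactSpace (absoluteGaloisGroup L) :=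
    fun L _ => absoluteGaloisGroup_compactSpace L
  haveI : NeZero (p ^ M) := ⟨pow_ne_zero _ hp.ne_zero⟩
  have hq2 : 2 ≤ p ^ M := le_trans hp.two_le (Nat.le_self_pow (by omega) p)
  have hqK : ((p ^ M : ℕ) : K) ≠ 0 := Nat.cast_ne_zero.mpr (NeZero.ne (p ^ M))
  -- the Weil pairing on `E[p^M]` over `K`
  obtain ⟨e, hμ, hadd₁, hadd₂, halt, hnondeg, hgal⟩ :=
    (W.baseChange K).exists_weilPairing_holds (p ^ M) hq2 hqK
  refine ⟨MuCarrier K (p ^ M), inferInstance,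
    weilPairingHom (W.baseChange K) (p ^ M) e hμ hadd₁ hadd₂,
    weilPairingHom_self (W.baseChange K) (p ^ M) e hμ hadd₁ hadd₂ halt,
    TameCup.weilPairingHom_left_nondeg (W.baseChange K) (p ^ M) e hμ hadd₁ hadd₂ halt hnondeg, ?_⟩
  intro s hs c' hc'fin hc'inf 𝔔 h𝔔 F hF hFfix σ hσ
  -- ### the family of local invariant maps of the Poitou–Tate fact at level `p^M`
  obtain ⟨inv, hperf, hsum⟩ := hPT (p ^ M)
  set lam := hℓ.place
  -- ### local terms vanish off `λ`: both classes satisfy the Kummer condition there (isotropy)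
  have hsS : s ∈ ((W.baseChange K).kummerSelmerStructure ((p ^ M : ℕ) : ℤ)).selmerGroup := by
    rw [← selmerGroup_eq_selmerGroup_kummerSelmerStructure]; exact hs
  have hloc_s : ∀ v : Place K, galoisCohomology.localization ((W.baseChange K).torsionGaloisModule ((p ^ M : ℕ) : ℤ)) v 1 s ∈
      (W.baseChange K).kummerSelmerStructure ((p ^ M : ℕ) : ℤ) v :=
    ((((W.baseChange K).kummerSelmerStructure ((p ^ M : ℕ) : ℤ)).mem_selmerGroup_iff s).mp hsS)
  have hloc_c' : ∀ v : Place K, v ≠ Sum.inr lam →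
      galoisCohomology.localization ((W.baseChange K).torsionGaloisModule ((p ^ M : ℕ) : ℤ)) v 1 c' ∈
        (W.baseChange K).kummerSelmerStructure ((p ^ M : ℕ) : ℤ) v := by
    intro v hv
    have hmem : c' ∈ selmerLocalKer (W.baseChange K) (Place.Completion v) ((p ^ M : ℕ) : ℤ) := by
      rcases v with w | v
      · exact hc'inf w
      · refine hc'fin v (fun h => hv ?_)
        rw [hℓ.mem_iff.mp h]
    rw [← (W.baseChange K).comap_localization_kummerSelmerStructure ((p ^ M : ℕ) : ℤ) v] at hmem
    exact hmem
  have hS : ∀ v ∉ ({Sum.inr lam} : Finset (Place K)),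
      inv v ((weilContPairingLocal (W.baseChange K) (p ^ M) e hμ hadd₁ hadd₂ hgal v).cupProduct
        (galoisCohomology.localization ((W.baseChange K).torsionGaloisModule ((p ^ M : ℕ) : ℤ)) v 1 s)
        (galoisCohomology.localization ((W.baseChange K).torsionGaloisModule ((p ^ M : ℕ) : ℤ)) v 1 c')) = 0 := by
    intro v hv
    rw [Finset.mem_singleton] at hv
    have h0 := (W.baseChange K).cupProduct_eq_zero_of_mem_kummerSelmerStructure_of_fact (p ^ M) e
      (by exact_mod_cast NeZero.ne (p ^ M)) v (kummerClass_cupProduct_kummerClass_eq_zero_holds (Place.Completion v))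
      hμ hadd₁ hadd₂ halt hgal (hloc_s v) (hloc_c' v hv)
    exact (congrArg (inv v) h0).trans (map_zero _)
  -- ### Poitou–Tate: the local term at `λ` vanishes too, hence the local cup product is zero
  have hPTsum := sum_inv_weilCupProduct_localization_eq_zero (W.baseChange K) (p ^ M) e hμ hadd₁ hadd₂ hgal
    inv hsum s c' {Sum.inr lam} hS
  rw [Finset.sum_singleton] at hPTsum
  have hcup : ((weilContPairing (W.baseChange K) (p ^ M) e hμ hadd₁ hadd₂ hgal).restrict
      (absGaloisRestrict K (lam.adicCompletion K))).cupProduct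
        (galoisCohomology.localization ((W.baseChange K).torsionGaloisModule ((p ^ M : ℕ) : ℤ)) (Sum.inr lam) 1 s)
        (galoisCohomology.localization ((W.baseChange K).torsionGaloisModule ((p ^ M : ℕ) : ℤ)) (Sum.inr lam) 1 c') = 0 :=
    (hperf lam).1.injective (hPTsum.trans (map_zero _).symm)
  -- ### the local step (FILE 1b) at `K_λ`: bridge `Γ_K`-decomposition data ↔ `Γ_{K_λ}`
  haveI : Fact p.Prime := ⟨hp⟩
  haveI : CharZero (lam.adicCompletion K) :=
    charZero_of_injective_algebraMap (algebraMap K (lam.adicCompletion K)).injective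
  have hp0 : ((p ^ M : ℕ) : ℤ) ≠ 0 := by exact_mod_cast NeZero.ne (p ^ M)
  -- good reduction at `λ`, `p ∉ λ`, `p ^ M ∉ λ`
  have hgood : (W.baseChange K).HasGoodReductionAt lam :=
    hasGoodReductionAt_place_of_isKolyvaginPrime_of_conductorNorm W hN hℓ
  have hpv : ((p : ℕ) : 𝓞 K) ∉ lam.asIdeal :=
    not_natCast_mem_of_prime_ne hℓ.prime hp hℓ.2.2.2.1 lam hℓ.mem_place
  have hqv : ((((p ^ M : ℕ) : ℤ)) : 𝓞 K) ∉ lam.asIdeal := by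
    rw [Int.cast_natCast, Nat.cast_pow]
    exact fun h => hpv (lam.isPrime.mem_of_pow_mem M h)
  -- the prime `𝔓₀ ∣ λ` cut out by `K̄ → \bar K_λ`; `g • 𝔔 = 𝔓₀` (transitivity of `Γ_K`)
  have h𝔓₀ : adicCompletionPrime K lam ∈ lam.primesAbove := adicCompletionPrime_mem_primesAbove K lam
  obtain ⟨g, hg⟩ := HeightOneSpectrum.exists_smul_eq_of_mem_primesAbove_holds h𝔔 h𝔓₀
  have hDeq := decompositionSubgroup_adicCompletionPrime_eq_range K lam
  have hIeq := inertia_adicCompletionPrime_eq_map_absInertia K lam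
  -- `F₀ = g F g⁻¹` is a Frobenius at `𝔓₀` fixing `E[p^M]`; `σ₀ = g σ g⁻¹ ∈ I_{𝔓₀}`
  have hF₀ : IsArithFrobAt (𝓞 K) (g * F * g⁻¹) (adicCompletionPrime K lam) := by
    have h := hF.conj g
    rwa [hg] at h
  have hF₀fix : g * F * g⁻¹ ∈ torsionFixing (W.baseChange K) ((p ^ M : ℕ) : ℤ) :=
    (torsionFixing_normal (W.baseChange K) _).conj_mem F hFfix g
  have hσ₀ : g * σ * g⁻¹ ∈ (adicCompletionPrime K lam).inertia (absoluteGaloisGroup K) := by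
    rw [← hg]
    intro x
    have hx := Ideal.smul_mem_pointwise_smul g _ 𝔔 (hσ (g⁻¹ • x))
    rwa [smul_sub, smul_inv_smul, ← mul_smul, ← mul_smul] at hx
  -- inertia at `𝔓₀` fixes `E[p^M]` (good reduction, `λ ∤ p`)
  have hI₀ : (adicCompletionPrime K lam).inertia (absoluteGaloisGroup K) ≤
      torsionFixing (W.baseChange K) ((p ^ M : ℕ) : ℤ) := fun τ hτ =>
    (mem_torsionFixing_iff _ _).mpr fun Q =>
      (W.baseChange K).smul_geomTorsion_eq_of_mem_inertia hgood hqv h𝔓₀ hτ Q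
  have hσ₀fix : g * σ * g⁻¹ ∈ torsionFixing (W.baseChange K) ((p ^ M : ℕ) : ℤ) := hI₀ hσ₀
  -- `F₀ = res gF`, `σ₀ = res t` with `t ∈ I_{K_λ}` (`D_{𝔓₀} = res Γ_{K_λ}`, `I_{𝔓₀} = res I_{K_λ}`)
  obtain ⟨gF, hgF⟩ : ∃ gF : absoluteGaloisGroup (lam.adicCompletion K),
      absGaloisRestrict K (lam.adicCompletion K) gF = g * F * g⁻¹ := by
    have hmem : g * F * g⁻¹ ∈
        (adicCompletionPrime K lam).decompositionSubgroup (absoluteGaloisGroup K) :=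
      hF₀.mem_stabilizer
    rw [hDeq] at hmem
    obtain ⟨gF, hgF⟩ := hmem
    exact ⟨gF, hgF⟩
  obtain ⟨t, ht, hgt⟩ : ∃ t ∈ absInertia (lam.adicCompletion K),
      absGaloisRestrict K (lam.adicCompletion K) t = g * σ * g⁻¹ := by
    have hmem := hσ₀
    rw [hIeq] at hmem
    obtain ⟨t, ht, hgt⟩ := hmem
    exact ⟨t, ht, hgt⟩
  -- `Γ_{K_λ}` acts trivially on `E[p^M]`: `D_{𝔓₀} = ⟨F₀⟩ · I_{𝔓₀} · Γ_{K(E[p^M])}`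
  have htriv : ∀ (g' : absoluteGaloisGroup (lam.adicCompletion K))
      (Q : geomTorsion (W.baseChange K) ((p ^ M : ℕ) : ℤ)),
      absGaloisRestrict K (lam.adicCompletion K) g' • Q = Q := by
    intro g' Q
    have hd : absGaloisRestrict K (lam.adicCompletion K) g' ∈
        (adicCompletionPrime K lam).decompositionSubgroup (absoluteGaloisGroup K) := by
      rw [hDeq]; exact ⟨g', rfl⟩
    obtain ⟨k, i, u, hi, hu, hdeq⟩ := exists_eq_frobenius_pow_mul_of_mem_decompositionSubgroup
      h𝔓₀ hF₀ (isOpen_torsionFixing (W.baseChange K) hp0) hd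
    have hmem : absGaloisRestrict K (lam.adicCompletion K) g' ∈
        torsionFixing (W.baseChange K) ((p ^ M : ℕ) : ℤ) := by
      rw [hdeq]
      exact Subgroup.mul_mem _ (Subgroup.mul_mem _ (Subgroup.pow_mem _ hF₀fix k) (hI₀ hi)) hu
    exact smul_eq_of_mem_torsionFixing _ _ hmem Q
  -- the residue characteristic of `K_λ` is prime to `p ^ M` (`λ ∤ p`)
  have hn : ¬ ringChar 𝓀[lam.adicCompletion K] ∣ p ^ M := fun h =>
    Summit.BirchSwinnertonDyer.Rank1Residual.GaloisImage.ringChar_residueField_adicCompletion_ne_of_not_mem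
      lam p hpv
      ((Nat.prime_dvd_prime_iff_eq (ringChar_residueField_prime (F := lam.adicCompletion K)) hp).mp
        ((ringChar_residueField_prime (F := lam.adicCompletion K)).dvd_of_dvd_pow h)).symm
  -- a frame `E[p^M] ≃ (ℤ/p^M)²`
  obtain ⟨ε₀⟩ := nonempty_addEquiv_geomTorsion (W.baseChange K) p M hM
    (Nat.cast_ne_zero.mpr hp.ne_zero)
  let ε : geomTorsion (W.baseChange K) ((p ^ M : ℕ) : ℤ) ≃+ ZMod (p ^ M) × ZMod (p ^ M) :=
    ε₀.trans (LinearEquiv.finTwoArrow ℤ (ZMod (p ^ M))).toAddEquiv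
  -- the injective local invariant map at `λ`
  have hinv : Function.Injective (inv (Sum.inr lam)) := (hperf lam).1.injective
  -- the local cocycles: restrictions to `Γ_{K_λ}` of the chosen cocycles of `s` and `c'`
  let φ : contOneCocycles (DiscreteGaloisModule.toTopRep (GaloisRep.restrictField
      (lam.adicCompletion K) ((W.baseChange K).torsionGaloisModule ((p ^ M : ℕ) : ℤ)))) :=
    contOneCocycles.pullback (absGaloisRestrict K (lam.adicCompletion K))
      (X := discreteTopRep (absoluteGaloisGroup K) (geomTorsion (W.baseChange K) ((p ^ M : ℕ) : ℤ)))
      (Y := DiscreteGaloisModule.toTopRep (GaloisRep.restrictField (lam.adicCompletion K)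
        ((W.baseChange K).torsionGaloisModule ((p ^ M : ℕ) : ℤ))))
      (TopRep.ofHom ⟨ContinuousLinearMap.id ℤ _, fun _ => rfl⟩)
      (reprCocycle (W.baseChange K) ((p ^ M : ℕ) : ℤ) s)
  let ψ : contOneCocycles (DiscreteGaloisModule.toTopRep (GaloisRep.restrictField
      (lam.adicCompletion K) ((W.baseChange K).torsionGaloisModule ((p ^ M : ℕ) : ℤ)))) :=
    contOneCocycles.pullback (absGaloisRestrict K (lam.adicCompletion K))
      (X := discreteTopRep (absoluteGaloisGroup K) (geomTorsion (W.baseChange K) ((p ^ M : ℕ) : ℤ)))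
      (Y := DiscreteGaloisModule.toTopRep (GaloisRep.restrictField (lam.adicCompletion K)
        ((W.baseChange K).torsionGaloisModule ((p ^ M : ℕ) : ℤ))))
      (TopRep.ofHom ⟨ContinuousLinearMap.id ℤ _, fun _ => rfl⟩)
      (reprCocycle (W.baseChange K) ((p ^ M : ℕ) : ℤ) c')
  have hφcl : galoisCohomology.localization ((W.baseChange K).torsionGaloisModule ((p ^ M : ℕ) : ℤ))
      (Sum.inr lam) 1 s = oneCocycleClass _ φ := by
    have h := (W.baseChange K).res_torsionGaloisModule_oneCocycleClass ((p ^ M : ℕ) : ℤ)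
      (lam.adicCompletion K) (reprCocycle (W.baseChange K) ((p ^ M : ℕ) : ℤ) s)
    rw [oneCocycleClass_reprCocycle] at h
    exact h
  have hψcl : galoisCohomology.localization ((W.baseChange K).torsionGaloisModule ((p ^ M : ℕ) : ℤ))
      (Sum.inr lam) 1 c' = oneCocycleClass _ ψ := by
    have h := (W.baseChange K).res_torsionGaloisModule_oneCocycleClass ((p ^ M : ℕ) : ℤ)
      (lam.adicCompletion K) (reprCocycle (W.baseChange K) ((p ^ M : ℕ) : ℤ) c')
    rw [oneCocycleClass_reprCocycle] at h
    exact h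
  rw [hφcl, hψcl] at hcup
  -- `φ` vanishes on `I_{K_λ}`: `s` is Selmer at the good place `λ ∤ p^M` (Gross (7.1))
  have hsel : s ∈ selmerLocalKer (W.baseChange K) (lam.adicCompletion K) ((p ^ M : ℕ) : ℤ) :=
    ((mem_selmerGroup_iff (W.baseChange K) _ s).mp hs).1 lam
  have hsI : ∀ τ ∈ (adicCompletionPrime K lam).inertia (absoluteGaloisGroup K),
      (reprCocycle (W.baseChange K) ((p ^ M : ℕ) : ℤ) s).1 τ = 0 := by
    have h := hsel
    rw [← oneCocycleClass_reprCocycle (W.baseChange K) ((p ^ M : ℕ) : ℤ) s] at h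
    exact ((W.baseChange K).oneCocycleClass_mem_selmerLocalKer_iff hgood hqv h𝔓₀ _).mp h
  have hφ : ∀ t' ∈ absInertia (lam.adicCompletion K), φ.1 t' = 0 := by
    intro t' ht'
    have hmem : absGaloisRestrict K (lam.adicCompletion K) t' ∈
        (adicCompletionPrime K lam).inertia (absoluteGaloisGroup K) := by
      rw [hIeq]; exact ⟨t', ht', rfl⟩
    have h0 : (reprCocycle (W.baseChange K) ((p ^ M : ℕ) : ℤ) s).1
        (absGaloisRestrict K (lam.adicCompletion K) t') = 0 := hsI _ hmem
    rw [contOneCocycles.pullback_apply, h0, map_zero]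
  -- FILE 1b at `K_λ`: `e([s, F₀], [c', σ₀]) = 1`
  have hloc := TameCup.weilPairing_apply_eq_one_of_cupProduct_eq_zero (W.baseChange K) (p ^ M)
    e hμ hadd₁ hadd₂ (lam.adicCompletion K) halt hnondeg hgal ε hn htriv (inv (Sum.inr lam)) hinv
    φ ψ hφ hcup gF t ht
  rw [contOneCocycles.pullback_apply, contOneCocycles.pullback_apply, hgF, hgt] at hloc
  change e (h1Eval (W.baseChange K) ((p ^ M : ℕ) : ℤ) s (g * F * g⁻¹))
    (h1Eval (W.baseChange K) ((p ^ M : ℕ) : ℤ) c' (g * σ * g⁻¹)) = 1 at hloc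
  -- transport along `g`: `[s, F] = g⁻¹ • [s, F₀]`, `[c', σ] = g⁻¹ • [c', σ₀]`, `e` equivariant
  have hconjF : g⁻¹ * (g * F * g⁻¹) * g⁻¹⁻¹ = F := by group
  have hconjσ : g⁻¹ * (g * σ * g⁻¹) * g⁻¹⁻¹ = σ := by group
  have h1 : h1Eval (W.baseChange K) ((p ^ M : ℕ) : ℤ) s F =
      g⁻¹ • h1Eval (W.baseChange K) ((p ^ M : ℕ) : ℤ) s (g * F * g⁻¹) := by
    rw [← h1Eval_conj (W.baseChange K) _ s g⁻¹ hF₀fix, hconjF]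
  have h2 : h1Eval (W.baseChange K) ((p ^ M : ℕ) : ℤ) c' σ =
      g⁻¹ • h1Eval (W.baseChange K) ((p ^ M : ℕ) : ℤ) c' (g * σ * g⁻¹) := by
    rw [← h1Eval_conj (W.baseChange K) _ c' g⁻¹ hσ₀fix, hconjσ]
  rw [TameCup.weilPairingHom_eq_zero_iff, h1, h2, ← hgal, hloc, smul_one]

/-! ### §2 The index guard: `p ∤ [E(K) : ℤP]` and `P` non-torsion give `P ∉ pE(K)` -/
/-- For `Q` of infinite order, `p ∣ [G : ℤ(p•Q)]` (`[G : ℤpQ] = [G : ℤQ]·p`, index `0` read as `∞`) —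
adapted from the tree's private `MatarNekovar2019.dvd_index_zmultiples_nsmul`. [folklore] -/
theorem dvd_index_zmultiples_nsmul_of_not_isOfFinAddOrder {G : Type*} [AddCommGroup G] (Q : G)
    (hQ : ¬ IsOfFinAddOrder Q) (p : ℕ) : p ∣ (AddSubgroup.zmultiples (p • Q)).index := by
  set H := AddSubgroup.zmultiples (p • Q) with hH
  have hHK : H ≤ AddSubgroup.zmultiples Q :=
    AddSubgroup.zmultiples_le_of_mem ((AddSubgroup.zmultiples Q).nsmul_mem (AddSubgroup.mem_zmultiples Q) p)
  have h1 : H.relIndex (AddSubgroup.zmultiples Q) ∣ H.index :=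
    ⟨_, (AddSubgroup.relIndex_mul_index hHK).symm⟩
  refine dvd_trans ?_ h1
  have h2 : H.relIndex (AddSubgroup.zmultiples Q) = (H.comap (zmultiplesHom G Q)).index := by
    rw [← AddSubgroup.range_zmultiplesHom, AddMonoidHom.range_eq_map, ← AddSubgroup.relIndex_comap,
      AddSubgroup.relIndex_top_right]
  rw [h2]
  have hinj : Function.Injective fun n : ℤ => n • Q := injective_zsmul_iff_not_isOfFinAddOrder.mpr hQ
  have h3 : H.comap (zmultiplesHom G Q) ≤ AddSubgroup.zmultiples (p : ℤ) := by
    intro n hn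
    rw [AddSubgroup.mem_comap, hH, AddSubgroup.mem_zmultiples_iff] at hn
    obtain ⟨m, hm⟩ := hn
    have hm' : (m * p : ℤ) • Q = n • Q := by
      rw [← smul_smul, natCast_zsmul]
      simpa using hm
    have hmn : m * p = n := hinj hm'
    exact AddSubgroup.mem_zmultiples_iff.mpr ⟨m, by rw [← hmn, smul_eq_mul]⟩
  refine dvd_trans ?_ (AddSubgroup.index_dvd_of_le h3)
  rw [AddSubgroup.index, Nat.card_congr (Int.quotientZMultiplesNatEquivZMod p).toEquiv, Nat.card_zmod]

/-- **The index guard.** For `P` of infinite order with `0 < [G : ℤP]` and `ord_p [G : ℤP] = 0` (the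
hypothesis of S1 `stub_inert_unitIndex`, plus the guard `0 < index` that S1 as registered lacks — cell memo
S1S2-ROAD-19718 §1; McCallum 1991 Lemma 5.1 reads `M₀ = ord_p [E(K) : ℤy_K]` for a FINITE index):
`P ∉ pG`. [cite: McCallumLMS1991, §5 Lemma 5.1] -/
theorem nsmul_ne_of_padicValNat_index_eq_zero {G : Type*} [AddCommGroup G] {P : G}
    (hP : ¬ IsOfFinAddOrder P) {p : ℕ} (hp : p.Prime) (hidx0 : 0 < (AddSubgroup.zmultiples P).index)
    (hidx : padicValNat p (AddSubgroup.zmultiples P).index = 0) (Q : G) : p • Q ≠ P := by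
  rintro rfl
  have hQ : ¬ IsOfFinAddOrder Q := fun h ↦ hP (h.nsmul (n := p))
  have hdvd := dvd_index_zmultiples_nsmul_of_not_isOfFinAddOrder Q hQ p
  rcases padicValNat.eq_zero_iff.mp hidx with h | h | h
  · exact hp.one_lt.ne' h
  · omega
  · exact h hdvd

/-! ### §3 S1's shape on the 19718 ∧ (ii) locus, modulo the ring-class-rational carrier and Poitou–Tate -/

/-- **S1's conclusion `#Ш(E/K)[p^∞] ≤ p^{2·ord_p[E(K):ℤP]}` (here `= 1`) on the 19718 ∧ (ii) locus, from
the ring-class-rational Euler-system data and the Poitou–Tate named fact.** Binders: the crux's (`W`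
globally minimal of conductor `N`, `[Fact p.Prime]`, `5 ≤ p`, `ρ̄_{E,p}` onto, `K` imaginary quadratic,
`hin`, `hsp`) + `ι : K → ℂ` + `hTam` (option (ii)) + `P ∈ E(K)` non-torsion with
`padicValNat p [E(K):ℤP] = 0` AND the guard `0 < [E(K):ℤP]` + `hpointsR` (leaf (A′) with rationality in
place of the Selmer clause, see `…MachineEntry` §4) + `hPT` (Poitou–Tate, cite-only named fact ⇒ this
theorem is CONDITIONAL on it). Proof: (R)_M from §1, `P ∉ pE(K)` from §2, `Ш(E/K)[p^∞] = 0` from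
`sha_primary_eq_zero_of_ringClassRationalPointsM` (p470900); the `p`-primary component is `⊥`. HONEST: S1
stays OPEN — the gap to its registered signature is exactly {`hpointsR` (printed carrier), `hPT`, `hTam`,
`0 < index`}; S1's data `Dt X W' P₀ degS` + GZ display are not used. [cite: GrossLMS1991, Prop. 2.1 (2)]
[cite: McCallumLMS1991, §1 Theorem (Kolyvagin), Lemma 5.1] [cite: MilneADT2006, Ch. I Thm. 4.10(b)] -/
theorem natCard_primaryComponent_sha_le_of_ringClassRationalPointsM_of_poitouTate
    (hPT : poitouTate_sum_localTatePairing_eq_zero K)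
    (W : WeierstrassCurve ℚ) [W.IsElliptic] [W.IsGloballyMinimal] {N : ℕ} [NeZero N]
    (hN : W.conductorNorm ℤ = N) {p : ℕ} [Fact p.Prime] (hp5 : 5 ≤ p)
    (hρ : W.HasSurjectiveModNGaloisRep p) (hK : IsImaginaryQuadratic K) (ι : K →+* ℂ)
    {S : Finset ℕ}
    (hin : ∀ ℓ ∈ S, ℓ.Prime ∧ ℓ ∣ N ∧ ¬ ℓ ^ 2 ∣ N ∧
      ((Ideal.span {(ℓ : ℤ)}).primesOver (𝓞 K)).ncard = 1 ∧ ¬ (ℓ : ℤ) ∣ NumberField.discr K)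
    (hsp : ∀ ℓ : ℕ, ℓ.Prime → ℓ ∣ N → ℓ ∉ S → ((Ideal.span {(ℓ : ℤ)}).primesOver (𝓞 K)).ncard = 2)
    (hTam : ∀ (ℓ : ℕ) [Fact ℓ.Prime], ℓ ∉ S → W.HasMultiplicativeReductionAtPrime ℓ →
      ¬ p ∣ padicValInt ℓ W.minimalDiscriminantInt)
    {P : (W.baseChange K).toAffine.Point} (hnt : ¬ IsOfFinAddOrder P)
    (hidx0 : 0 < (AddSubgroup.zmultiples P).index)
    (hidx : padicValNat p (AddSubgroup.zmultiples P).index = 0)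
    (hpointsR : ∀ {M : ℕ} (_hM : 1 ≤ M)
      (hdiv : ∀ Q : geomPoints (W.baseChange K), ∃ R, ((p ^ M : ℕ) : ℤ) • R = Q)
      (c : K ≃ₐ[ℚ] K) (_hc : c ≠ 1),
      ∃ (ε : ℤ) (τ : AlgebraicClosure K ≃+* AlgebraicClosure K) (hτ : IsLiftOfAut c τ)
        (A : ℕ → AddSubgroup (geomPoints (W.baseChange K)))
        (hA : ∀ m, KolyvaginCocycle.IsAdmissible (Field.absoluteGaloisGroup K) (A m)
          ((p ^ M : ℕ) : ℤ))
        (emb : ∀ m : ℕ, ringClassField K ι m →ₐ[K] AlgebraicClosure K)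
        (Pt : ℕ → geomPoints (W.baseChange K))
        (hPt : ∀ m, Pt m ∈
          KolyvaginCocycle.invPoints (Field.absoluteGaloisGroup K) (A m) ((p ^ M : ℕ) : ℤ)),
        (ε = 1 ∨ ε = -1) ∧
        IsOfFinAddOrder (Affine.Point.map (W' := W) (c : K →ₐ[ℚ] K) P - ε • P) ∧
        (∀ m, ∀ a ∈ A m, hτ.pointsMap W a ∈ A m) ∧
        Pt 1 = toGeomPoints (W.baseChange K) P ∧
        (∀ m, m ≠ 0 → ∀ a ∈ A m, ∀ Φ : Field.absoluteGaloisGroup K,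
          (∀ x : ringClassField K ι m, Φ • emb m x = emb m x) → Φ • a = a) ∧
        (∀ m : ℕ, Squarefree m →
          (∀ q ∈ m.primeFactors, IsKolyvaginPrime N W K p q ∧ FrobEqFrobInfty W K (p ^ M) q) →
          (∃ B ∈ A m, hτ.pointsMap W (Pt m) =
            (ε * (-1) ^ m.primeFactors.card) • Pt m + ((p ^ M : ℕ) : ℤ) • B) ∧
          (∀ ℓ : ℕ, ℓ.Prime → ℓ ∣ m → ∀ v : HeightOneSpectrum (𝓞 K), (ℓ : 𝓞 K) ∈ v.asIdeal →
            ∀ a : ℕ, (((p : ℤ) ^ a) •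
                kolyvaginClass (W.baseChange K) _ hdiv (hA m) (Pt m) (hPt m) ∈
                selmerLocalKer (W.baseChange K) (v.adicCompletion K) ((p ^ M : ℕ) : ℤ) ↔
              ((p : ℤ) ^ a) • kolyvaginClass (W.baseChange K) _ hdiv (hA (m / ℓ)) (Pt (m / ℓ))
                  (hPt (m / ℓ)) ∈
                (W.baseChange K).torsionLocalKer (v.adicCompletion K) ((p ^ M : ℕ) : ℤ))))) :
    Nat.card (AddCommGroup.primaryComponent (W.baseChange K).sha p) ≤
      p ^ (2 * padicValNat p (AddSubgroup.zmultiples P).index) := by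
  have hp : p.Prime := Fact.out
  have hndvd : ∀ Q : (W.baseChange K).toAffine.Point, p • Q ≠ P :=
    nsmul_ne_of_padicValNat_index_eq_zero hnt hp hidx0 hidx
  have h0 := sha_primary_eq_zero_of_ringClassRationalPointsM W hN hp hp5 hρ hK ι hin hsp hTam hnt hndvd
    hpointsR (@fun _ hM _ hℓ _ ↦ kolyvaginReciprocityM_of_poitouTate_of_conductorNorm W hN hPT hp hM hℓ)
  have hbot : AddCommGroup.primaryComponent (W.baseChange K).sha p = ⊥ := by
    refine (AddSubgroup.eq_bot_iff_forall _).mpr fun x hx ↦ ?_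
    obtain ⟨n, hn⟩ := (AddCommGroup.mem_primaryComponent).1 hx
    exact h0 x ⟨n, hn⟩
  rw [hbot, AddSubgroup.card_bot, hidx, mul_zero, pow_zero]

end Summit.BirchSwinnertonDyer.BirchSwinnertonDyer.Theorems

end
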